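import Summits.QuantumFields.YangMills.Theorems.FluctuationComparisonRegPrIntLS2BetaStaircaseSlotStokes
import Summits.QuantumFields.YangMills.Theorems.UnitScaleTiltAvgActionDefectLoops
import Literature.MathematicalPhysics.QuantumFieldTheory.Balaban1983to89.BlockAveragingEMLProp2
import Literature.MathematicalPhysics.QuantumFieldTheory.Balaban1983to89.B15DeterminingSets
import Literature.MathematicalPhysics.QuantumFieldTheory.Balaban1983to89.T4Continuum
import HarnessLib

/-!
# S2β · (REG-UP)′ bridge (O2-b3-β1) — «THE AVERAGED COARSE BOND VS THE STRAIGHT FINE WORD»: the `hline` letter of ✓(O2-b3-α) `hDcov_of_letters`: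
# `‖↑(Ū^k U₀ ⟨ȳ, μ⟩) − ↑(U₀[ι_k ȳ, ι_k ȳ + L^k e_μ])‖ ≤ ε_k` with `ε_0 = 0`, `L·ε_i + 2θ_i ≤ ε_{i+1}` from the (0.4) loop guards `θ_i` of the averaged tower

Cell `ym3-torus` (YM ladder rung R3 = continuum `SU(2)` Yang–Mills on the three-torus at fixed lattice data — a RUNG: NOT d = 4, NOT infinite volume, NOT a mass gap,
NOT Clay).  Width seat «width 12» `ym3-torus-px12` (gen 27); crux `stmt-QuantumFields-20520`, LINE g18-1 S2β, node (REG-UP)′ (hDcov assembly, px12 g27 03:07Z claim).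
`--kind proof --supports stmt-QuantumFields-20520 --as helper`, count-neutral, DEFINITION-FREE (0 `def`, 0 `instance`, 0 `notation`, 0 `sorry`, default heartbeats).
Generic `P : Params`; §1–§2 for any `GaugeGroup`; §3–§4 for `SU(N)` with the PRINTED `exp[mean log]` averaging (lit ✓`BlockAveragingEMLProp2.dist1_corr_le_two_mul`).

THE MECHANISM ([Balaban1987RG1] (0.4): `Ū(c) = κ_c · U(Γ_c)`, correction factor × straight word of `L` bonds).  By induction on the level: a straight word of `n` bonds of `Ū^{i+1}U₀`
from `z` is, factor by factor, `κ · (straight word of L bonds of Ū^i U₀ from ι z′)`; dropping the correction factors costs `dist1 κ ≤ 2θ_i` per factor (lit, from the loop guard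
`θ_i ≤ 1∕6`, `θ_i < δ_N`), and the remaining word of `n·L` level-`i` bonds is within `n·L·ε_i` of the fine straight word of `n·L·L^i = n·L^{i+1}` bonds from `ι_{i+1} z`
(`ι_i (shiftN z μ n) = shiftN (ι_i z) μ (n·L^i)`, lit ✓`emb_shift`).  Distances compose by `dist1 (A·c·B·(A′B′)⁻¹) ≤ dist1 (A A′⁻¹) + dist1 c + dist1 (B B′⁻¹)` (conjugation
invariance + subadditivity of `dist1`).

WHAT IS PROVED (sorry-free).
§1 `dist1_mul_mul_mul_inv_le` (the three-factor composition rule), `emb_shiftN`, `embIter_shiftN` (`ι_k (z + n e_μ) = ι_k z + n·L^k e_μ`, `k ≤ m + K`), `transfUp_rowProd`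
   (`(x ↦ U₀[x, x + n e_μ])_k ȳ = U₀[ι_k ȳ, ι_k ȳ + n e_μ]`), `iter_succ_apply_eq_corr_mul_rowProd` (`Ū^{i+1}U₀ (c) = κ_c · rowProd (Ū^i U₀) (ι c₋) c.dir L`).
§2 ★★`dist1_rowProd_iter_mul_inv_le` — for every sequence `ε` with `ε 0 = 0`, `L·ε i + 2θ i ≤ ε (i+1)` (`i < k`) and loop guards `θ_i` below `k`:
   `∀ n z, dist1 (rowProd (Ū^k U₀) z μ n · (rowProd U₀ (ι_k z) μ (n·L^k))⁻¹) ≤ n·ε k`.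
§3 ★★★**`norm_coe_iter_sub_coe_transfUp_rowProd_le`** — THE `hline` LETTER OF ✓(O2-b3-α): **`‖↑(Ū^k U₀ ⟨ȳ, μ⟩) − ↑(transfUp (x ↦ rowProd U₀ x μ L^k) k ȳ)‖ ≤ ε k`** (`n = 1`;
   `‖↑G − ↑u‖ = dist1 (G·u⁻¹)` on `SU(N)`).
§4 `geomSeq_of_theta` — the least solution `ε k = Σ_{i<k} L^{k−1−i}·2θ_i` satisfies the recursion (bookkeeping for consumers; with `θ_i ≤ C·α·L^{2i}η²` it is `≤ C′·α·L^{2k}η²∕(L²−L)`,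
   K-uniform — px20 g25 ✓`geom_mixed_sum`).

HONEST SCOPE.  Group algebra on the torus + the tree's correction-factor bound; nothing of Bałaban's renormalisation-group analysis proved ([Balaban1987RG1] (0.4) p.253 and [Balaban1985Averaging]
(9), (19) pp.19–21 are the printed conventions); the `hLip` letter of (O2-b3-α), (hNL)∕(REG-UP)′∕GAP♯∘ (`stub_uniformFibreGapOrbit`, registry 3732b7df UNTOUCHED, 0∕5), the five registered
stubs, S2β, crux 20520, 19936, 19200, `YM3TorusSU2` — NOT proved; rung R3 — NOT d = 4, NOT infinite volume, NOT a mass gap, NOT Clay; the Yang–Mills mass gap is NOT proved.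
-/

set_option autoImplicit false

noncomputable section

open scoped Matrix.Norms.L2Operator

namespace Summit.QuantumFields.YangMills.Theorems.FluctuationComparisonRegPrIntLS2BetaAveragedBondStraightWord

open Literature.MathematicalPhysics.QuantumFieldTheory.Balaban1983to89
open Literature.MathematicalPhysics.QuantumFieldTheory.Balaban1983to89.BlockAveraging (Small Idx avgFun loopHol blockAvg blockAvg_avg corr)
open Literature.MathematicalPhysics.QuantumFieldTheory.Balaban1983to89.BlockAveragingEMLProp2 (dist1_corr_le_two_mul)
open Literature.MathematicalPhysics.QuantumFieldTheory.Balaban1983to89.ExpMeanLog (expMeanLogSU deltaSU)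
open Literature.MathematicalPhysics.QuantumFieldTheory.Balaban1983to89.T4Continuum (transfUp axialAvg_eq_holAt_walk)
open Literature.MathematicalPhysics.QuantumFieldTheory.Balaban1983to89.B10Eq47AxialChi (shiftN shiftN_zero shiftN_succ rowProd rowProd_zero rowProd_succ emb_shift)
open Literature.MathematicalPhysics.QuantumFieldTheory.Balaban1983to89.B15DeterminingSets (embIter)
open Summit.QuantumFields.YangMills.Theorems.AvgActionDefect (holAt_walk_replicate rowProd_succ_left)
open Summit.QuantumFields.YangMills.Theorems.FluctuationComparisonRegPrIntLS2BetaStaircaseSlotStokes (rowProd_add)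

variable {P : Params}

/-! ## §1 Group and torus algebra -/

section Algebra

variable {G : Type*} [GaugeGroup G]

/-- The three-factor composition rule: `dist1 (A·c·B·(A′·B′)⁻¹) ≤ dist1 (A·A′⁻¹) + dist1 c + dist1 (B·B′⁻¹)` (`A c B B′⁻¹ A′⁻¹ = (A A′⁻¹)·A′(c·B B′⁻¹)A′⁻¹`). [folklore] -/
theorem dist1_mul_mul_mul_inv_le (A c B A' B' : G) :
    dist1 (A * c * B * (A' * B')⁻¹) ≤ dist1 (A * A'⁻¹) + dist1 c + dist1 (B * B'⁻¹) := by
  have hid : A * c * B * (A' * B')⁻¹ = (A * A'⁻¹) * (A' * (c * (B * B'⁻¹)) * A'⁻¹) := by group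
  rw [hid]
  refine (GaugeGroup.dist1_mul_le _ _).trans ?_
  rw [GaugeGroup.dist1_conj, add_assoc]
  exact add_le_add le_rfl (GaugeGroup.dist1_mul_le _ _)

/-- `shiftN (shiftN x μ a) μ b = shiftN x μ (a + b)`. [folklore] -/
theorem shiftN_shiftN_eq_add {j : ℕ} (x : Site P j) (μ : Fin P.d) (a : ℕ) : ∀ b : ℕ, shiftN (shiftN x μ a) μ b = shiftN x μ (a + b)
  | 0 => rfl
  | b + 1 => by rw [shiftN_succ, shiftN_shiftN_eq_add x μ a b, ← shiftN_succ, ← Nat.add_assoc]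

/-- `emb (shiftN z μ n) = shiftN (emb z) μ (n·L)` (`j + 1 ≤ m + K`; lit ✓`emb_shift` iterated). [cite: Balaban1987RG1, (0.1) p.251] -/
theorem emb_shiftN {j : ℕ} (hj : j + 1 ≤ P.m + P.K) (z : Site P (j + 1)) (μ : Fin P.d) :
    ∀ n : ℕ, emb (shiftN z μ n) = shiftN (emb z) μ (n * P.L)
  | 0 => by rw [shiftN_zero, zero_mul, shiftN_zero]
  | n + 1 => by
    rw [shiftN_succ, emb_shift hj, emb_shiftN hj z μ n, Nat.succ_mul, shiftN_shiftN_eq_add]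

/-- `ι_k (shiftN z μ n) = shiftN (ι_k z) μ (n·L^k)` for `k ≤ m + K` (`ι_k = embIter k`, lit ✓`B15DeterminingSets.embIter`). [cite: Balaban1987RG1, (0.1) p.251] -/
theorem embIter_shiftN (μ : Fin P.d) : ∀ (k : ℕ), k ≤ P.m + P.K → ∀ (z : Site P k) (n : ℕ),
    embIter k (shiftN z μ n) = shiftN (embIter k z) μ (n * P.L ^ k)
  | 0, _, z, n => by rw [pow_zero, mul_one]; rfl
  | k + 1, hk, z, n => by
    show embIter k (emb (shiftN z μ n)) = shiftN (embIter k (emb z)) μ (n * P.L ^ (k + 1))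
    rw [emb_shiftN hk z μ n, embIter_shiftN μ k (Nat.le_of_succ_le hk) (emb z) (n * P.L), pow_succ, mul_assoc, mul_comm (P.L) (P.L ^ k)]

/-- `(x ↦ U₀[x, x + n e_μ])_k ȳ = U₀[ι_k ȳ, ι_k ȳ + n e_μ]` (lit ✓`T4Continuum.transfUp` unfolds along `emb`). [cite: Balaban1985Averaging, (11) p.19] -/
theorem transfUp_rowProd (U₀ : GaugeField P 0 G) (μ : Fin P.d) (n : ℕ) : ∀ (k : ℕ) (y : Site P k),
    transfUp (fun x : Site P 0 => rowProd U₀ x μ n) k y = rowProd U₀ (embIter k y) μ n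
  | 0, _ => rfl
  | k + 1, y => transfUp_rowProd U₀ μ n k (emb y)

/-- `Ū^{i+1}U₀ (c) = κ_c · rowProd (Ū^i U₀) (ι c₋) c.dir L` — [Balaban1987RG1] (0.4) read through lit ✓`avgFun`∕`axialAvg_eq_holAt_walk` and ✓`holAt_walk_replicate`. [cite: Balaban1987RG1, (0.4) p.253] -/
theorem iter_succ_apply_eq_corr_mul_rowProd (ℰ : LoopAverage G) (U₀ : GaugeField P 0 G) (i : ℕ) (c : PBond P (i + 1)) :
    Averaging.iter (fun j => blockAvg (P := P) (j := j) ℰ) (i + 1) U₀ c =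
      corr ℰ (Averaging.iter (fun j => blockAvg (P := P) (j := j) ℰ) i U₀) c *
        rowProd (Averaging.iter (fun j => blockAvg (P := P) (j := j) ℰ) i U₀) (emb c.src) c.dir P.L := by
  show avgFun ℰ (Averaging.iter (fun j => blockAvg (P := P) (j := j) ℰ) i U₀) c = _
  show corr ℰ _ c * AveragingRT.axialAvg _ c = _
  rw [axialAvg_eq_holAt_walk, holAt_walk_replicate]

end Algebra

/-! ## §2 The averaged straight word vs the fine straight word -/

section Words

variable {N : ℕ} [NeZero N]

/-- ★★ **THE AVERAGED STRAIGHT WORD VS THE FINE STRAIGHT WORD**: for the (0.4)-averaged `SU(N)` tower `Ū^i U₀` with loop guards `dist1 (loopHol (Ū^i U₀) c ι) ≤ θ_i` (`i < k`,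
`θ_i ≤ 1∕6`, `θ_i < δ_N`) and any sequence `ε` with `ε 0 = 0`, `L·ε i + 2θ_i ≤ ε (i+1)`: `dist1 (rowProd (Ū^k U₀) z μ n · (rowProd U₀ (ι_k z) μ (n·L^k))⁻¹) ≤ n·ε k`
(`k ≤ m + K`). [cite: Balaban1987RG1, (0.4) p.253; Balaban1985Averaging, (9), (19) pp.19-21] -/
theorem dist1_rowProd_iter_mul_inv_le (U₀ : GaugeField P 0 (Matrix.specialUnitaryGroup (Fin N) ℂ)) (μ : Fin P.d) {θ ε : ℕ → ℝ}
    (hθδ : ∀ i, θ i < deltaSU (Fin N)) (hθ6 : ∀ i, θ i ≤ 1 / 6) (hε0 : ε 0 = 0) :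
    ∀ (k : ℕ), k ≤ P.m + P.K →
      (∀ i, i < k → ∀ (c : PBond P (i + 1)) (ι : Idx P),
        dist1 (loopHol (Averaging.iter (fun j => blockAvg (P := P) (j := j) (expMeanLogSU (n := Fin N))) i U₀) c ι) ≤ θ i) →
      (∀ i, i < k → (P.L : ℝ) * ε i + 2 * θ i ≤ ε (i + 1)) →
      ∀ (n : ℕ) (z : Site P k),
        dist1 (rowProd (Averaging.iter (fun j => blockAvg (P := P) (j := j) (expMeanLogSU (n := Fin N))) k U₀) z μ n *
          (rowProd U₀ (embIter k z) μ (n * P.L ^ k))⁻¹) ≤ n * ε k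
  | 0, _, _, _, n, z => by
    -- level `0`: `Ū^0 U₀ = U₀`, `ι_0 = id`, `L^0 = 1`: the two words coincide
    have h : rowProd (Averaging.iter (fun j => blockAvg (P := P) (j := j) (expMeanLogSU (n := Fin N))) 0 U₀) z μ n *
        (rowProd U₀ (embIter 0 z) μ (n * P.L ^ 0))⁻¹ = 1 := by
      rw [pow_zero, mul_one]; exact mul_inv_cancel _
    rw [h, GaugeGroup.dist1_one, hε0, mul_zero]
  | k + 1, hk, hθ, hε, n, z => by
    have hk' : k ≤ P.m + P.K := Nat.le_of_succ_le hk
    have IH := dist1_rowProd_iter_mul_inv_le U₀ μ hθδ hθ6 hε0 k hk' (fun i hi => hθ i (Nat.lt_succ_of_lt hi)) (fun i hi => hε i (Nat.lt_succ_of_lt hi))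
    -- induction on the word length `n`
    induction n generalizing z with
    | zero =>
      rw [rowProd_zero, zero_mul, rowProd_zero, inv_one, mul_one, GaugeGroup.dist1_one, Nat.cast_zero, zero_mul]
    | succ n ihn =>
      -- `rowProd W_{k+1} z μ (n+1) = (rowProd W_{k+1} z μ n)·(κ · rowProd W_k (ι c₋) μ L)` at `c = ⟨shiftN z μ n, μ⟩`
      rw [rowProd_succ, iter_succ_apply_eq_corr_mul_rowProd]
      -- the fine word of `(n+1)·L^{k+1}` bonds splits after `n·L^{k+1}`
      have hsplit : rowProd U₀ (embIter (k + 1) z) μ ((n + 1) * P.L ^ (k + 1)) =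
          rowProd U₀ (embIter (k + 1) z) μ (n * P.L ^ (k + 1)) * rowProd U₀ (embIter k (emb (shiftN z μ n))) μ (P.L * P.L ^ k) := by
        rw [Nat.succ_mul, rowProd_add, ← embIter_shiftN μ (k + 1) hk z n, pow_succ, mul_comm (P.L ^ k) P.L]
        rfl
      rw [hsplit, ← mul_assoc]
      refine (dist1_mul_mul_mul_inv_le _ _ _ _ _).trans ?_
      have h1 := ihn z
      have h2 : dist1 (corr (expMeanLogSU (n := Fin N)) (Averaging.iter (fun j => blockAvg (P := P) (j := j) (expMeanLogSU (n := Fin N))) k U₀)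
          (⟨shiftN z μ n, μ⟩ : PBond P (k + 1))) ≤ 2 * θ k :=
        dist1_corr_le_two_mul _ _ (hθ k (Nat.lt_succ_self k) ⟨shiftN z μ n, μ⟩) (hθδ k) (hθ6 k)
      have h3 := IH P.L (emb (shiftN z μ n))
      have hεk := hε k (Nat.lt_succ_self k)
      push_cast at h1 h3 ⊢
      nlinarith [h1, h2, h3, hεk]

/-! ## §3 The `hline` letter of (O2-b3-α) -/

/-- `‖↑G − ↑u‖ = dist1 (G·u⁻¹)` on `SU(N)` (`dist1 g = ‖↑g − 1‖`; right multiplication by a unitary is isometric). [folklore] -/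
theorem norm_coe_sub_coe_eq_dist1 (G u : Matrix.specialUnitaryGroup (Fin N) ℂ) :
    ‖(G : Matrix (Fin N) (Fin N) ℂ) - (u : Matrix (Fin N) (Fin N) ℂ)‖ = dist1 (G * u⁻¹) := by
  have hd : dist1 (G * u⁻¹) = ‖((G * u⁻¹ : Matrix.specialUnitaryGroup (Fin N) ℂ) : Matrix (Fin N) (Fin N) ℂ) - 1‖ := rfl
  have hu : (u : Matrix (Fin N) (Fin N) ℂ) ∈ unitary (Matrix (Fin N) (Fin N) ℂ) := Matrix.specialUnitaryGroup_le_unitaryGroup u.2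
  have hinv : ((u⁻¹ : Matrix.specialUnitaryGroup (Fin N) ℂ) : Matrix (Fin N) (Fin N) ℂ) = star (u : Matrix (Fin N) (Fin N) ℂ) := rfl
  have hus : star (u : Matrix (Fin N) (Fin N) ℂ) ∈ unitary (Matrix (Fin N) (Fin N) ℂ) := Unitary.star_mem hu
  rw [hd, Submonoid.coe_mul, hinv]
  have e : (G : Matrix (Fin N) (Fin N) ℂ) * star (u : Matrix (Fin N) (Fin N) ℂ) - 1 =
      ((G : Matrix (Fin N) (Fin N) ℂ) - (u : Matrix (Fin N) (Fin N) ℂ)) * star (u : Matrix (Fin N) (Fin N) ℂ) := by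
    rw [sub_mul, Unitary.mul_star_self_of_mem hu]
  rw [e, CStarRing.norm_mul_mem_unitary _ hus]

/-- ★★★ **THE `hline` LETTER OF ✓(O2-b3-α) `hDcov_of_letters`**: under the loop guards `θ_i` below `k` (`k ≤ m + K`) and `ε 0 = 0`, `L·ε i + 2θ_i ≤ ε (i+1)`:
**`‖↑(Ū^k U₀ ⟨ȳ, μ⟩) − ↑(transfUp (x ↦ rowProd U₀ x μ L^k) k ȳ)‖ ≤ ε k`** — the averaged coarse bond is within `ε_k` of the straight fine transport over `L^k` steps from the
representative `ι_k ȳ`. [cite: Balaban1987RG1, (0.4) p.253; Balaban1985Averaging, (9), (19) pp.19-21, Prop. 4 (128) p.37] -/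
theorem norm_coe_iter_sub_coe_transfUp_rowProd_le (U₀ : GaugeField P 0 (Matrix.specialUnitaryGroup (Fin N) ℂ)) (μ : Fin P.d) {k : ℕ} (hk : k ≤ P.m + P.K)
    {θ ε : ℕ → ℝ} (hθδ : ∀ i, θ i < deltaSU (Fin N)) (hθ6 : ∀ i, θ i ≤ 1 / 6)
    (hθ : ∀ i, i < k → ∀ (c : PBond P (i + 1)) (ι : Idx P),
      dist1 (loopHol (Averaging.iter (fun j => blockAvg (P := P) (j := j) (expMeanLogSU (n := Fin N))) i U₀) c ι) ≤ θ i)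
    (hε0 : ε 0 = 0) (hε : ∀ i, i < k → (P.L : ℝ) * ε i + 2 * θ i ≤ ε (i + 1)) (y : Site P k) :
    ‖((Averaging.iter (fun j => blockAvg (P := P) (j := j) (expMeanLogSU (n := Fin N))) k U₀ ⟨y, μ⟩ : Matrix.specialUnitaryGroup (Fin N) ℂ) : Matrix (Fin N) (Fin N) ℂ) -
        ((transfUp (fun x : Site P 0 => rowProd U₀ x μ (P.L ^ k)) k y : Matrix.specialUnitaryGroup (Fin N) ℂ) : Matrix (Fin N) (Fin N) ℂ)‖ ≤ ε k := by
  rw [norm_coe_sub_coe_eq_dist1, transfUp_rowProd]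
  have h := dist1_rowProd_iter_mul_inv_le U₀ μ hθδ hθ6 hε0 k hk hθ hε 1 y
  rw [Nat.cast_one, one_mul, one_mul] at h
  have h1 : rowProd (Averaging.iter (fun j => blockAvg (P := P) (j := j) (expMeanLogSU (n := Fin N))) k U₀) y μ 1 =
      Averaging.iter (fun j => blockAvg (P := P) (j := j) (expMeanLogSU (n := Fin N))) k U₀ ⟨y, μ⟩ := by
    rw [rowProd_succ, rowProd_zero, one_mul, shiftN_zero]
  rwa [h1] at h

end Words

/-! ## §4 The least solution of the recursion -/

/-- `ε k := Σ_{i<k} L^{k−1−i}·(2θ_i)` satisfies `ε 0 = 0` and `L·ε k + 2θ_k = ε (k+1)` (bookkeeping; with `θ_i ≤ c·L^{2i}` this is px20 g25's ✓`geom_mixed_sum` shape, K-uniform). [folklore] -/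
theorem geomSeq_of_theta (L : ℝ) (θ : ℕ → ℝ) (k : ℕ) :
    L * (∑ i ∈ Finset.range k, L ^ (k - 1 - i) * (2 * θ i)) + 2 * θ k = ∑ i ∈ Finset.range (k + 1), L ^ (k + 1 - 1 - i) * (2 * θ i) := by
  rw [Finset.sum_range_succ, Finset.mul_sum]
  congr 1
  · refine Finset.sum_congr rfl fun i hi => ?_
    rw [Finset.mem_range] at hi
    rw [← mul_assoc, ← pow_succ', show k - 1 - i + 1 = k + 1 - 1 - i by omega]
  · rw [show k + 1 - 1 - k = 0 by omega, pow_zero, one_mul]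

end Summit.QuantumFields.YangMills.Theorems.FluctuationComparisonRegPrIntLS2BetaAveragedBondStraightWord

end
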